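import Literature.Geometry.Kaehler.ComplexTorusHodgeEndSymmetricProjectors
import Literature.Geometry.Kaehler.ComplexTorusPullbackAndreDaggerUnitary
import HarnessLib

/-!
# The HODGE subalgebra of André's `†`-algebra: rational operators on `H•(X; ℚ)` commuting with the WHOLE circle `(e^{iθ})^*` (Deligne's `S¹`-action,
# i.e. preserving every weight space `⊕_{p−q=d} H^{p,q}`) form a `†`-stable `ℚ`-subalgebra `hodgeRatEndCircle Φ` of the Weil-operator commutant
# `hodgeRatEnd Φ`; and André's Prop. 3.3 / Remarque 1, von Neumann regularity and Kaplansky's `†`-symmetric projectors hold in EVERY `†`-stable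
# `ℚ`-subalgebra `S ≤ hodgeRatEnd Φ` — in particular in `hodgeRatEndCircle Φ`

Layer `Literature/Geometry/Kaehler`, namespace `Literature.Geometry.Kaehler.ComplexTorus`; lane `lit-hodgefound` (Track 2 foundations library),
prover seat `lit-hodgefound-p35` (generation 54, row g54-#2; sequel of g54-#1 `ComplexTorusHodgeEndSymmetricProjectors` (Kaplansky's formula, `†`-symmetric
projectors in `hodgeRatEnd Φ`), g52-#6 `ComplexTorusHodgeRationalEndSemisimple` (`hodgeRatEnd Φ`, Remarque 1), g53-#8 `ComplexTorusHodgeEndRangesSplit` (von Neumann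
regularity), g53-#1 `ComplexTorusPullbackAndreDaggerUnitary` (`[(e^{iθ})^*, M^*] = 0` for `ℂ`-linear `M`) and row A1-44 `ComplexTorusKaehlerLieAlgebra` §10 (`rotG`,
`weightSpace`, `rotCommutant`)). ONE DEFINITION WITH BODY (`hodgeRatEndCircle`) + theorems; no named fact, no instance, no notation; D-0026 net debt `0`.

THE POINT (and a CAVEAT on the tree's vocabulary). The tree's `hodgeRatEnd Φ` (row g52-#6) is the `ℚ`-algebra of RATIONAL operators on `H•(X; ℚ)` commuting with
the single Weil operator `C = rotG E (π/2) = (e^{iπ/2})^*`, which acts on `H^{p,q}` by `i^{p−q}`: it is the commutant of `C`, and `C` only separates the Hodge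
types `p − q` MODULO `4` (on `H²`: `C = −1` on `H^{2,0} ⊕ H^{0,2}`, `+1` on `H^{1,1}`). An operator commuting with `C` therefore need not preserve `H^{2,0}`: on a
complex torus whose transcendental part `T_ℚ ⊗ ℂ = H^{2,0} ⊕ H^{0,2}` is rational (CM abelian surfaces), EVERY rational endomorphism of `T_ℚ`, extended by `0`,
lies in `hodgeRatEnd Φ`, but only those preserving the line `H^{2,0}` are Hodge endomorphisms. The genuine Hodge condition is commutation with the whole circle
`(e^{iθ})^*`, `θ ∈ ℝ` (Deligne's action `h` of `U¹` on `V_ℂ`, "`h(z)` acts on `V^{p,q}` by `z^{-p} z̄^{-q}`", here `e^{i(p−q)θ}`): such operators preserve every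
weight space `weightSpace E d = ⊕_{p−q=d} H^{p,q}` (row A1-44), i.e. are exactly the (Tate-twist-normalised) morphisms of `ℚ`-Hodge structures between the
`Hᵏ(X; ℚ)`; the Lefschetz operators `L`, `Λ`, the Weyl element `w`, André's `*_H` and the pull-backs `f^*`, `f ∈ End_ℚ(X)`, all qualify. THIS FILE (§1) defines that
subalgebra `hodgeRatEndCircle Φ ≤ hodgeRatEnd Φ` and proves it `†`-STABLE; (§2) runs André's argument (positivity of `Tr(u u†)` kills nil ideals; Artinian ⟹
`J = 0` ⟹ semisimple ⟹ von Neumann regular ⟹ projectors onto images/along kernels; Kaplansky ⟹ `†`-symmetric ones, unique) for EVERY `†`-stable `ℚ`-subalgebra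
`S ≤ hodgeRatEnd Φ` — all the g52-#6/g53-#8/g54-#1 statements hold with `S` in place of `hodgeRatEnd Φ`, with NO hypothesis `η ∈ NS(X)` beyond the Kähler datum
(`†`-stability is the hypothesis); (§3) specialises to `S = hodgeRatEndCircle Φ` (`η ∈ NS(X) ⊗ ℚ` makes it `†`-stable). All earlier statements about `hodgeRatEnd Φ`
remain true as stated (André's positivity uses only `C`); their gloss "`End_{ℚ-HS}(H•(X; ℚ))`" is to be read as "the `C`-commutant", and `hodgeRatEndCircle Φ` is
the endomorphism algebra of the Tate-normalised total cohomology `⊕_{k even} Hᵏ(X)(k/2) ⊕ ⊕_{k odd} Hᵏ(X)((k−1)/2)`.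

## What is defined / proved

* §1 **def `hodgeRatEndCircle Φ`** (`{u ∈ 𝔤𝔩(H•(X; ℚ)) | ∀ θ, [(e^{iθ})^*, u] = 0}`, a `ℚ`-subalgebra), `mem_hodgeRatEndCircle_iff`, **`hodgeRatEndCircle_le_hodgeRatEnd`**,
  `mem_rotCommutant_of_mem_hodgeRatEndCircle` / `mem_hodgeRatEndCircle_of_mem_rotCommutant` (= `rationalEnd ⊓ rotCommutant`), **`apply_mem_weightSpace_of_mem_hodgeRatEndCircle`**
  (its elements preserve every `⊕_{p−q=d} H^{p,q}`), `mem_hodgeRealEnd_of_mem_hodgeRatEndCircle`; members: **`IsNSForm.lefschetzG_mem_hodgeRatEndCircle`**, `…lefschetzDualG…`,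
  `…weylOperator…`, `…andreHodgeInvolution…`, **`pullAlgHom_analyticRepHom_mem_hodgeRatEndCircle`** (`f^*` for `f ∈ End_ℚ(X)`); `†`-STABILITY:
  `commute_rotG_poincareTranspose` (`[(e^{iθ})^*, ᵗu] = 0`), **`poincareTranspose_mem_hodgeRatEndCircle`**, **`IsNSForm.andreDagger_mem_hodgeRatEndCircle`**;
  `moduleFinite_hodgeRatEndCircle`.
* §2 EVERY `†`-STABLE `ℚ`-SUBALGEBRA `S ≤ hodgeRatEnd Φ` (`η` a Kähler datum: type (1,1), `η(iu,u) > 0`, non-degenerate; `e : Fin (2g) ≃ ι`): `moduleFinite_of_le_hodgeRatEnd`,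
  `isArtinianRing_of_le_hodgeRatEnd`, **`jacobson_eq_bot_of_andreDagger_mem`** (Remarque 1: `J(S) = 0`), **`isSemisimpleRing_of_andreDagger_mem`** (Prop. 3.3),
  **`exists_mem_mul_mul_eq_self_of_andreDagger_mem`** (von Neumann regularity in `S`), `exists_isIdempotentElem_mem_range_eq_of_andreDagger_mem_rat` /
  `…_ker_eq_…` (`S`-projectors onto `Im u`, along `Ker u`), **`exists_isIdempotentElem_andreDagger_eq_mem_range_eq_of_andreDagger_mem_rat`** (Kaplansky: the `†`-SYMMETRIC
  one, in `u S`), `existsUnique_…`, **`…_ker_eq_…`**, `existsUnique_…`.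
* §3 `hodgeRatEndCircle Φ` for `η ∈ NS(X) ⊗ ℚ` Kähler: **`IsNSForm.isSemisimpleRing_hodgeRatEndCircle`**, `IsNSForm.exists_mem_hodgeRatEndCircle_mul_mul_eq_self`,
  **`IsNSForm.existsUnique_isIdempotentElem_andreDagger_eq_mem_hodgeRatEndCircle_range_eq`** / `…_ker_eq`; the `IsRiemannForm.…` forms.

## Sources, VERBATIM

* P. Deligne, *Hodge cycles on abelian varieties* (notes by J. Milne), in LNM 900 (1982) [Deligne1982HodgeCycles], I §1: "a real Hodge structure on `V` defines an action
  `h` of `U¹` on `V_ℂ` […] `h(z)` acts on `V^{p,q}` as multiplication by `z^{-p} z̄^{-q}`" and morphisms of Hodge structures are the linear maps commuting with `h`;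
  C. Voisin, *Hodge Theory and Complex Algebraic Geometry I* (2002) [Voisin2002], §2.3.1 (the weight `p − q` of a `(p,q)`-form under `z ↦ e^{iθ} z`).
* Y. André, *Pour une théorie inconditionnelle des motifs*, Publ. Math. IHÉS **83** (1996) [Andre1996Motifs]: Prop. 2.3 (p. 16) ("stable par transposition"), Prop. 3.3
  (p. 21) ("La `ℚ`-algèbre `C⁰_mot(X, X)` est semi-simple de dimension finie […] définie positive"), Appendice Remarque 1 (p. 47) (nil right ideals vanish), §4.2 (p. 19)
  (idempotents have kernels and images, Jannsen's Lemma 2).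
* S. K. Berberian, *Baer `*`-Rings* (1972) [Berberian1972BaerRings], §1 Prop. 1 (3), §1 Exercise 7C (p. 11) (= Kaplansky, *Rings of Operators* (1968), Thm. 26
  [Kaplansky1968RingsOfOperators]), §3 Exercise 6A (p. 19) (`*`-regular rings).
* T. Y. Lam, *A First Course in Noncommutative Rings* [Lam2001FirstCourse], (4.27); I. N. Herstein, *Noncommutative Rings* [Herstein1994], Thm. 1.3.1, Thm. 1.4.2.

## Scope

No sub-Hodge-structure objects are built; `hodgeRatEndCircle Φ` is characterised through `rotG` and `weightSpace` only. The example separating `hodgeRatEnd` from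
`hodgeRatEndCircle` is described, not formalised.
-/

noncomputable section

-- instance search through the subalgebras `S ≤ hodgeRatEnd Φ` of `Module.End ℂ (GForm E ℂ)` (rows g52-#5/#6, g53-#8, g54-#1 precedent)
set_option synthInstance.maxHeartbeats 400000
set_option maxSynthPendingDepth 3

namespace Literature.Geometry.Kaehler

namespace ComplexTorus

open Module Function
open Literature.LinearAlgebra.Alternating Literature.Algebra.Lie Literature.Analysis.Complex

universe uE

variable {ι : Type*} [Fintype ι] [DecidableEq ι] {E : Type uE} [NormedAddCommGroup E] [NormedSpace ℂ E] [FiniteDimensional ℂ E]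
  (Φ : (ι → ℝ) ≃L[ℝ] E) {η : E [⋀^Fin 2]→L[ℝ] ℝ} {N : ℕ}

/-! ## §1 The circle commutant `hodgeRatEndCircle Φ`: rational operators commuting with every `(e^{iθ})^*` -/

section Circle

/-- **The Hodge subalgebra `End_{ℚ-HS}` of the total cohomology**: the `ℚ`-algebra of `ℂ`-linear operators on `H•(X; ℂ)` preserving the rational classes
`H•(X; ℚ) = rationalFormsG Φ` and commuting with the WHOLE circle action `(e^{iθ})^*`, `θ ∈ ℝ` (Deligne's `S¹`-action `h`, acting on `H^{p,q}` by `e^{i(p−q)θ}`) —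
equivalently (§1) preserving every weight space `⊕_{p−q=d} H^{p,q}`: the morphisms of `ℚ`-Hodge structures between the `Hᵏ(X; ℚ)` up to Tate twist. A subalgebra
of the Weil-operator commutant `hodgeRatEnd Φ` (`θ = π/2`). [cite: Deligne1982HodgeCycles, I §1] [cite: Voisin2002, §2.3.1] [cite: Andre1996Motifs, Prop. 2.3 (p. 16), §4 (p. 23)] -/
def hodgeRatEndCircle : Subalgebra ℚ (Module.End ℂ (GForm E ℂ)) where
  carrier := {u | u ∈ rationalEnd Φ ∧ ∀ θ : ℝ, Commute (rotG E θ) u}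
  mul_mem' hu hv := ⟨(rationalEnd Φ).mul_mem hu.1 hv.1, fun θ ↦ (hu.2 θ).mul_right (hv.2 θ)⟩
  one_mem' := ⟨(rationalEnd Φ).one_mem, fun _ ↦ Commute.one_right _⟩
  add_mem' hu hv := ⟨(rationalEnd Φ).add_mem hu.1 hv.1, fun θ ↦ (hu.2 θ).add_right (hv.2 θ)⟩
  zero_mem' := ⟨(rationalEnd Φ).zero_mem, fun _ ↦ Commute.zero_right _⟩
  algebraMap_mem' q := ⟨(rationalEnd Φ).algebraMap_mem q, fun _ ↦ Algebra.commute_algebraMap_right q _⟩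

omit [Fintype ι] [DecidableEq ι] [FiniteDimensional ℂ E] in
/-- Membership: `u ∈ hodgeRatEndCircle Φ` iff `u` is rational and commutes with every `(e^{iθ})^*`. [cite: Deligne1982HodgeCycles, I §1] -/
theorem mem_hodgeRatEndCircle_iff (u : Module.End ℂ (GForm E ℂ)) : u ∈ hodgeRatEndCircle Φ ↔ u ∈ rationalEnd Φ ∧ ∀ θ : ℝ, Commute (rotG E θ) u := Iff.rfl

omit [Fintype ι] [DecidableEq ι] [FiniteDimensional ℂ E] in
/-- **`hodgeRatEndCircle Φ ≤ hodgeRatEnd Φ`**: commuting with the circle implies commuting with the Weil operator `C = (e^{iπ/2})^*`.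
[cite: Deligne1982HodgeCycles, I §1] [cite: Andre1996Motifs, §1.1 (p. 11)] -/
theorem hodgeRatEndCircle_le_hodgeRatEnd : hodgeRatEndCircle Φ ≤ hodgeRatEnd Φ := fun _ hu ↦ ⟨hu.1, hu.2 _⟩

omit [Fintype ι] [DecidableEq ι] [FiniteDimensional ℂ E] in
/-- Elements of `hodgeRatEndCircle Φ` lie in the circle commutant `rotCommutant E` of row A1-44. [cite: Voisin2002, §2.3.1] -/
theorem mem_rotCommutant_of_mem_hodgeRatEndCircle {u : Module.End ℂ (GForm E ℂ)} (hu : u ∈ hodgeRatEndCircle Φ) : u ∈ rotCommutant E := fun θ ω ↦ by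
  rw [← Module.End.mul_apply, ← (hu.2 θ).eq, Module.End.mul_apply]

omit [Fintype ι] [DecidableEq ι] [FiniteDimensional ℂ E] in
/-- `hodgeRatEndCircle Φ = 𝔤𝔩(H•(X; ℚ)) ⊓ rotCommutant`: a rational operator in the circle commutant belongs to `hodgeRatEndCircle Φ`. [cite: Voisin2002, §2.3.1] -/
theorem mem_hodgeRatEndCircle_of_mem_rotCommutant {u : Module.End ℂ (GForm E ℂ)} (hu : u ∈ rationalEnd Φ) (hrot : u ∈ rotCommutant E) : u ∈ hodgeRatEndCircle Φ :=
  ⟨hu, fun θ ↦ LinearMap.ext fun ω ↦ by rw [Module.End.mul_apply, Module.End.mul_apply, hrot θ ω]⟩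

omit [Fintype ι] [DecidableEq ι] [FiniteDimensional ℂ E] in
/-- **Elements of `hodgeRatEndCircle Φ` preserve every weight space `⊕_{p−q=d} H^{p,q}`** — the Hodge-type condition. [cite: Deligne1982HodgeCycles, I §1]
[cite: Voisin2002, §2.3.1] -/
theorem apply_mem_weightSpace_of_mem_hodgeRatEndCircle {u : Module.End ℂ (GForm E ℂ)} (hu : u ∈ hodgeRatEndCircle Φ) {d : ℤ} {ω : GForm E ℂ}
    (hω : ω ∈ weightSpace E d) : u ω ∈ weightSpace E d := fun θ ↦ by
  rw [← Module.End.mul_apply, (hu.2 θ).eq, Module.End.mul_apply, hω θ, map_smul]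

omit [DecidableEq ι] in
/-- `hodgeRatEndCircle Φ ⊆ End_{ℝ-HS}` (real, commuting with `C`). [cite: Deligne1982HodgeCycles, I §1] -/
theorem mem_hodgeRealEnd_of_mem_hodgeRatEndCircle {u : Module.End ℂ (GForm E ℂ)} (hu : u ∈ hodgeRatEndCircle Φ) : u ∈ hodgeRealEnd E :=
  mem_hodgeRealEnd_of_mem_hodgeRatEnd Φ (hodgeRatEndCircle_le_hodgeRatEnd Φ hu)

variable [Nontrivial E]

omit [Fintype ι] [DecidableEq ι] [FiniteDimensional ℂ E] [Nontrivial E] in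
/-- **`L_η ∈ hodgeRatEndCircle Φ`** for `η ∈ NS(X) ⊗ ℚ` (rational, type `(1,1)`: `e^{iθ}` preserves `η`). [cite: Andre1996Motifs, §1.1 (p. 10), Prop. 1.2 (p. 11)]
[cite: Voisin2002, §6.2.2 Rem. 6.23] -/
theorem IsNSForm.lefschetzG_mem_hodgeRatEndCircle (hNS : IsNSForm Φ η) : (lefschetzG η : Module.End ℂ (GForm E ℂ)) ∈ hodgeRatEndCircle Φ := by
  refine ⟨(hNS.lefschetzG_mem_hodgeRatEnd Φ).1, fun θ ↦ ?_⟩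
  rw [rotG_eq_pullAlgHom]
  exact commute_pullAlgHom_lefschetzG (twoForm_rotateCLM hNS.type_one_one _)

/-- **`Λ_η ∈ hodgeRatEndCircle Φ`** for `η ∈ NS(X) ⊗ ℚ` non-degenerate. [cite: Andre1996Motifs, §1.1 (p. 10), Prop. 1.2 (p. 11)] [cite: Voisin2002, §6.2.2 Rem. 6.23] -/
theorem IsNSForm.lefschetzDualG_mem_hodgeRatEndCircle (hNS : IsNSForm Φ η) (hη : ∀ v : E, v ≠ 0 → ∃ w : E, η ![v, w] ≠ 0) :
    (lefschetzDualG η : Module.End ℂ (GForm E ℂ)) ∈ hodgeRatEndCircle Φ := by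
  refine ⟨(hNS.lefschetzDualG_mem_hodgeRatEnd Φ hη).1, fun θ ↦ ?_⟩
  rw [rotG_eq_pullAlgHom]
  exact commute_pullAlgHom_lefschetzDualG hη (twoForm_rotateCLM hNS.type_one_one _)

/-- **The Weyl element `w ∈ hodgeRatEndCircle Φ`** (`η ∈ NS(X) ⊗ ℚ` non-degenerate). [cite: Andre1996Motifs, §1.2 (p. 11)] -/
theorem IsNSForm.weylOperator_mem_hodgeRatEndCircle (hNS : IsNSForm Φ η) (hη : ∀ v : E, v ≠ 0 → ∃ w : E, η ![v, w] ≠ 0) :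
    (hasLefschetzProperty_lefschetzG hη).weylOperator isZGrading_countingG ∈ hodgeRatEndCircle Φ :=
  ⟨(hNS.weylOperator_mem_hodgeRatEnd Φ hη).1, fun θ ↦ commute_rotG_weylOperator hNS.type_one_one hη θ⟩

/-- **André's `*_H ∈ hodgeRatEndCircle Φ`** (`η ∈ NS(X) ⊗ ℚ` non-degenerate, normalisation `d = g`). [cite: Andre1996Motifs, §1.1 (p. 10), Prop. 1.2 (p. 11)] -/
theorem IsNSForm.andreHodgeInvolution_mem_hodgeRatEndCircle (hNS : IsNSForm Φ η) (hη : ∀ v : E, v ≠ 0 → ∃ w : E, η ![v, w] ≠ 0) :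
    (hasLefschetzProperty_lefschetzG hη).andreHodgeInvolution isZGrading_countingG (finrank ℂ E) ∈ hodgeRatEndCircle Φ :=
  ⟨(hNS.andreHodgeInvolution_mem_hodgeRatEnd Φ hη).1, fun θ ↦ commute_rotG_andreHodgeInvolution hNS.type_one_one hη θ _⟩

omit [Nontrivial E] [FiniteDimensional ℂ E] in
/-- **`f^* ∈ hodgeRatEndCircle Φ` for every `f ∈ End_ℚ(X) = endAlgRat Φ`** (`ρ_a(f)` is `ℂ`-linear, so `f^*` commutes with every `(e^{iθ})^*`; `ρ_r(f)` is rational).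
[cite: Deligne1982HodgeCycles, I §1] [cite: Andre1996Motifs, §4 (p. 23)] -/
theorem pullAlgHom_analyticRepHom_mem_hodgeRatEndCircle (A : endAlgRat Φ) :
    (GForm.pullAlgHom ((analyticRepHom Φ A : E →L[ℂ] E).restrictScalars ℝ)).toLinearMap ∈ hodgeRatEndCircle Φ :=
  ⟨(pullAlgHom_analyticRepHom_mem_hodgeRatEnd Φ A).1, fun θ ↦ commute_rotG_pullAlgHom (fun c v ↦ (analyticRepHom Φ A).map_smul c v) θ⟩

omit [Nontrivial E] in
/-- **`[(e^{iθ})^*, ᵗu] = 0` whenever `[(e^{iθ'})^*, u] = 0` for all `θ'`**: the Poincaré transpose of an operator in the circle commutant is in the circle commutant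
(`ᵗ(e^{iθ})^* = (e^{−iθ})^*`). [cite: Andre1996Motifs, Prop. 2.3 (p. 16: "stable par transposition")] -/
theorem commute_rotG_poincareTranspose (e : Fin N ≃ ι) {u : Module.End ℂ (GForm E ℂ)} (hu : ∀ θ : ℝ, Commute (rotG E θ) u) (θ : ℝ) :
    Commute (rotG E θ) (poincareTranspose Φ e u) := by
  have h1 : poincareTranspose Φ e (u * rotG E (-θ)) = rotG E θ * poincareTranspose Φ e u := by
    rw [poincareTranspose_mul, poincareTranspose_rotG, neg_neg]
  have h2 : poincareTranspose Φ e (rotG E (-θ) * u) = poincareTranspose Φ e u * rotG E θ := by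
    rw [poincareTranspose_mul, poincareTranspose_rotG, neg_neg]
  change rotG E θ * poincareTranspose Φ e u = poincareTranspose Φ e u * rotG E θ
  rw [← h1, ← h2, (hu (-θ)).eq]

omit [Nontrivial E] in
/-- **`ᵗu ∈ hodgeRatEndCircle Φ` for `u ∈ hodgeRatEndCircle Φ`** ("stable par transposition"). [cite: Andre1996Motifs, Prop. 2.3 (p. 16)] -/
theorem poincareTranspose_mem_hodgeRatEndCircle (e : Fin N ≃ ι) {u : Module.End ℂ (GForm E ℂ)} (hu : u ∈ hodgeRatEndCircle Φ) :
    poincareTranspose Φ e u ∈ hodgeRatEndCircle Φ :=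
  ⟨poincareTranspose_mem_rationalEnd Φ e hu.1, commute_rotG_poincareTranspose Φ e hu.2⟩

/-- **`u† ∈ hodgeRatEndCircle Φ` for `u ∈ hodgeRatEndCircle Φ`** (`η ∈ NS(X) ⊗ ℚ` non-degenerate): the Hodge subalgebra is `†`-STABLE ("on peut faire agir l'involution `′`").
[cite: Andre1996Motifs, Prop. 3.3 (p. 21), Appendice Remarque 1 (p. 47)] -/
theorem IsNSForm.andreDagger_mem_hodgeRatEndCircle (hNS : IsNSForm Φ η) (hη : ∀ v : E, v ≠ 0 → ∃ w : E, η ![v, w] ≠ 0) (e : Fin N ≃ ι) {u : Module.End ℂ (GForm E ℂ)}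
    (hu : u ∈ hodgeRatEndCircle Φ) : andreDagger Φ hη e u ∈ hodgeRatEndCircle Φ := by
  rw [andreDagger_def]
  exact mul_mem (mul_mem (hNS.andreHodgeInvolution_mem_hodgeRatEndCircle Φ hη) (poincareTranspose_mem_hodgeRatEndCircle Φ e hu))
    (hNS.andreHodgeInvolution_mem_hodgeRatEndCircle Φ hη)

omit [DecidableEq ι] [Nontrivial E] in
/-- `hodgeRatEndCircle Φ` is finite-dimensional over `ℚ`. [cite: Andre1996Motifs, Prop. 3.3 (p. 21: "de dimension finie")] -/
theorem moduleFinite_hodgeRatEndCircle : Module.Finite ℚ (hodgeRatEndCircle Φ) := by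
  haveI := moduleFinite_hodgeRatEnd Φ
  exact Module.Finite.of_injective (Subalgebra.inclusion (hodgeRatEndCircle_le_hodgeRatEnd Φ)).toLinearMap
    (Subalgebra.inclusion_injective (hodgeRatEndCircle_le_hodgeRatEnd Φ))

end Circle

/-! ## §2 André's argument for every `†`-stable `ℚ`-subalgebra `S ≤ hodgeRatEnd Φ` -/

section Subalgebra

variable [Nontrivial E] (h11 : ∀ u v : E, η ![Complex.I • u, Complex.I • v] = η ![u, v]) (hpos : ∀ u : E, u ≠ 0 → 0 < η ![Complex.I • u, u])
  (hη : ∀ v : E, v ≠ 0 → ∃ w : E, η ![v, w] ≠ 0) {g : ℕ} (e : Fin (2 * g) ≃ ι) {S : Subalgebra ℚ (Module.End ℂ (GForm E ℂ))}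

omit [DecidableEq ι] [Nontrivial E] in
/-- A `ℚ`-subalgebra of `hodgeRatEnd Φ` is finite-dimensional over `ℚ`. [cite: Andre1996Motifs, Prop. 3.3 (p. 21)] -/
theorem moduleFinite_of_le_hodgeRatEnd (hS : S ≤ hodgeRatEnd Φ) : Module.Finite ℚ S := by
  haveI := moduleFinite_hodgeRatEnd Φ
  exact Module.Finite.of_injective (Subalgebra.inclusion hS).toLinearMap (Subalgebra.inclusion_injective hS)

omit [DecidableEq ι] [Nontrivial E] in
/-- A `ℚ`-subalgebra of `hodgeRatEnd Φ` is (left) Artinian. [cite: Herstein1994, Thm. 1.3.1] -/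
theorem isArtinianRing_of_le_hodgeRatEnd (hS : S ≤ hodgeRatEnd Φ) : IsArtinianRing S :=
  haveI := moduleFinite_of_le_hodgeRatEnd Φ hS
  IsArtinianRing.of_finite ℚ S

include h11 hpos in
/-- **André, Appendice Remarque 1, for a `†`-stable `ℚ`-subalgebra `S` of the `C`-commutant** (`η` a Kähler datum, `e : Fin (2g) ≃ ι`): the Jacobson radical of `S` is
ZERO — it is nilpotent (`S` is Artinian) and for `x ∈ J(S)`, `x x† ∈ J(S)` is nilpotent, so `x = 0` by the positivity of `Tr(x x†)`.
[cite: Andre1996Motifs, Appendice Remarque 1 (p. 47), Prop. 3.3 (p. 21)] [cite: Herstein1994, Thm. 1.3.1] -/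
theorem jacobson_eq_bot_of_andreDagger_mem (hS : S ≤ hodgeRatEnd Φ) (hSdag : ∀ u ∈ S, andreDagger Φ hη e u ∈ S) : Ring.jacobson S = ⊥ := by
  haveI := isArtinianRing_of_le_hodgeRatEnd Φ hS
  have hJ : IsNilpotent (Ideal.jacobson (⊥ : Ideal S)) := IsArtinianRing.isNilpotent_jacobson_bot
  rw [Ideal.jacobson_bot] at hJ
  obtain ⟨n, hn⟩ := hJ
  refine (Submodule.eq_bot_iff _).2 fun x hx ↦ ?_
  have hxs : x * ⟨andreDagger Φ hη e x, hSdag x x.2⟩ ∈ Ring.jacobson S := Ideal.mul_mem_right _ _ hx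
  have hxn : (x * ⟨andreDagger Φ hη e x, hSdag x x.2⟩) ^ n = 0 := by
    have h := Ideal.pow_mem_pow hxs n
    rw [hn] at h
    exact (Submodule.mem_bot _).1 h
  refine Subtype.ext (eq_zero_of_isNilpotent_mul_andreDagger Φ h11 hpos hη e (mem_hodgeRealEnd_of_mem_hodgeRatEnd Φ (hS x.2)) ⟨n, ?_⟩)
  have h := congrArg Subtype.val hxn
  rw [Subalgebra.coe_pow, Subalgebra.coe_mul] at h
  exact h

include h11 hpos hη e in
/-- **André's Prop. 3.3 for every `†`-stable `ℚ`-subalgebra `S ≤ hodgeRatEnd Φ`: `S` is SEMISIMPLE** (finite-dimensional with `J(S) = 0`).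
[cite: Andre1996Motifs, Prop. 3.3 (p. 21), Appendice Remarque 1 (p. 47)] [cite: Kleiman1968AlgebraicCycles, §3 Thm. 3.11] -/
theorem isSemisimpleRing_of_andreDagger_mem (hS : S ≤ hodgeRatEnd Φ) (hSdag : ∀ u ∈ S, andreDagger Φ hη e u ∈ S) : IsSemisimpleRing S := by
  haveI := isArtinianRing_of_le_hodgeRatEnd Φ hS
  exact IsArtinianRing.isSemisimpleRing_iff_jacobson.2 (jacobson_eq_bot_of_andreDagger_mem Φ h11 hpos hη e hS hSdag)

include h11 hpos hη e in
/-- **VON NEUMANN REGULARITY IN `S`**: every `u` in a `†`-stable `ℚ`-subalgebra `S ≤ hodgeRatEnd Φ` has a quasi-inverse `v ∈ S`, `u v u = u`.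
[cite: Andre1996Motifs, Prop. 3.3 (p. 21), §4.2 (p. 19)] [cite: Lam2001FirstCourse, (4.27)] -/
theorem exists_mem_mul_mul_eq_self_of_andreDagger_mem (hS : S ≤ hodgeRatEnd Φ) (hSdag : ∀ u ∈ S, andreDagger Φ hη e u ∈ S) {u : Module.End ℂ (GForm E ℂ)}
    (hu : u ∈ S) : ∃ v ∈ S, u * v * u = u := by
  haveI := isSemisimpleRing_of_andreDagger_mem Φ h11 hpos hη e hS hSdag
  obtain ⟨x, hx⟩ := exists_mul_mul_eq_self_of_isSemisimpleRing (⟨u, hu⟩ : S)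
  exact ⟨x, x.2, congrArg Subtype.val hx⟩

include h11 hpos hη e in
/-- **The image of `u ∈ S` is cut out by an idempotent `p = u v ∈ u S ⊆ S`**, `Im u ⊕ Ker p = H•` (Jannsen's Lemma 2 inside `S`).
[cite: Andre1996Motifs, §4.2 (p. 19)] [cite: Jannsen1992Motives, Lemma 2] -/
theorem exists_isIdempotentElem_mem_range_eq_of_andreDagger_mem_rat (hS : S ≤ hodgeRatEnd Φ) (hSdag : ∀ u ∈ S, andreDagger Φ hη e u ∈ S)
    {u : Module.End ℂ (GForm E ℂ)} (hu : u ∈ S) :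
    ∃ p ∈ S, IsIdempotentElem p ∧ LinearMap.range p = LinearMap.range u ∧ IsCompl (LinearMap.range u) (LinearMap.ker p) ∧ ∃ v ∈ S, p = u * v := by
  obtain ⟨v, hv, h⟩ := exists_mem_mul_mul_eq_self_of_andreDagger_mem Φ h11 hpos hη e hS hSdag hu
  exact ⟨u * v, S.mul_mem hu hv, isIdempotentElem_mul_of_mul_mul_eq_self h, range_mul_eq_of_mul_mul_eq_self h, isCompl_range_ker_of_mul_mul_eq_self h, v, hv, rfl⟩

include h11 hpos hη e in
/-- **The kernel of `u ∈ S` is the kernel of an idempotent `f = v u ∈ S u ⊆ S`**, `Im f ⊕ Ker u = H•`. [cite: Andre1996Motifs, §4.2 (p. 19)] [cite: Jannsen1992Motives, Lemma 2] -/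
theorem exists_isIdempotentElem_mem_ker_eq_of_andreDagger_mem_rat (hS : S ≤ hodgeRatEnd Φ) (hSdag : ∀ u ∈ S, andreDagger Φ hη e u ∈ S)
    {u : Module.End ℂ (GForm E ℂ)} (hu : u ∈ S) :
    ∃ f ∈ S, IsIdempotentElem f ∧ LinearMap.ker f = LinearMap.ker u ∧ IsCompl (LinearMap.range f) (LinearMap.ker u) ∧ ∃ v ∈ S, f = v * u := by
  obtain ⟨v, hv, h⟩ := exists_mem_mul_mul_eq_self_of_andreDagger_mem Φ h11 hpos hη e hS hSdag hu
  exact ⟨v * u, S.mul_mem hv hu, isIdempotentElem_mul_of_mul_mul_eq_self' h, ker_mul_eq_of_mul_mul_eq_self h, isCompl_range_ker_of_mul_mul_eq_self' h, v, hv, rfl⟩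

include h11 hpos in
/-- **KAPLANSKY IN `S`: the `†`-SYMMETRIC projector onto `Im u` lies in `u S`** for every `u` in a `†`-stable `ℚ`-subalgebra `S ≤ hodgeRatEnd Φ` (`η` a Kähler datum):
`f² = f = f†`, `Im f = Im u`, `f = u v'`. [cite: Berberian1972BaerRings, §1 Exercise 7C (p. 11), §3 Exercise 6A (p. 19)] [cite: Kaplansky1968RingsOfOperators, Thm. 26]
[cite: Andre1996Motifs, Prop. 3.3 (p. 21), §4.2 (p. 19)] -/
theorem exists_isIdempotentElem_andreDagger_eq_mem_range_eq_of_andreDagger_mem_rat (hS : S ≤ hodgeRatEnd Φ) (hSdag : ∀ u ∈ S, andreDagger Φ hη e u ∈ S)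
    {u : Module.End ℂ (GForm E ℂ)} (hu : u ∈ S) :
    ∃ f ∈ S, IsIdempotentElem f ∧ andreDagger Φ hη e f = f ∧ LinearMap.range f = LinearMap.range u ∧ ∃ v ∈ S, f = u * v := by
  obtain ⟨p, hp, hpi, hpr, -, v, hv, hpv⟩ := exists_isIdempotentElem_mem_range_eq_of_andreDagger_mem_rat Φ h11 hpos hη e hS hSdag hu
  have hpd : andreDagger Φ hη e p ∈ S := hSdag p hp
  have hx : p - andreDagger Φ hη e p ∈ S := sub_mem hp hpd
  have ha : 1 + andreDagger Φ hη e (p - andreDagger Φ hη e p) * (p - andreDagger Φ hη e p) ∈ S := add_mem (one_mem _) (mul_mem (hSdag _ hx) hx)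
  haveI := moduleFinite_of_le_hodgeRatEnd Φ hS
  obtain ⟨w, hw, haw, hwa⟩ := exists_mem_mul_eq_one_of_isUnit ha (isUnit_one_add_andreDagger_mul Φ h11 hpos hη e (mem_hodgeRealEnd_of_mem_hodgeRatEnd Φ (hS hx)))
  have hσσ : andreDagger Φ hη e (andreDagger Φ hη e p) = p := andreDagger_andreDagger Φ hη e (hS hp).2
  obtain ⟨hfi, hfd, hfe, hef⟩ :=
    kaplansky_projection (σ := andreDagger Φ hη e) (andreDagger_mul Φ hη e) (andreDagger_add Φ hη e) (andreDagger_one Φ hη e) hpi hσσ haw hwa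
  refine ⟨p * andreDagger Φ hη e p * w, mul_mem (mul_mem hp hpd) hw, hfi, hfd, ?_, v * (andreDagger Φ hη e p * w), mul_mem hv (mul_mem hpd hw), ?_⟩
  · rw [← hpr]
    exact range_eq_of_mul_eq_of_mul_eq hfe hef
  · subst hpv
    simp only [mul_assoc]

include h11 hpos in
/-- **UNIQUE EXISTENCE of the `†`-symmetric idempotent with image `Im u`; it lies in `S`.** [cite: Berberian1972BaerRings, §1 Prop. 1 (3), Exercise 7C (p. 11)]
[cite: Kaplansky1968RingsOfOperators, Thm. 26] -/
theorem existsUnique_isIdempotentElem_andreDagger_eq_mem_range_eq_of_andreDagger_mem_rat (hS : S ≤ hodgeRatEnd Φ) (hSdag : ∀ u ∈ S, andreDagger Φ hη e u ∈ S)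
    {u : Module.End ℂ (GForm E ℂ)} (hu : u ∈ S) :
    ∃! f : Module.End ℂ (GForm E ℂ), f ∈ S ∧ IsIdempotentElem f ∧ andreDagger Φ hη e f = f ∧ LinearMap.range f = LinearMap.range u := by
  obtain ⟨f, hf, hfi, hfd, hfr, -⟩ := exists_isIdempotentElem_andreDagger_eq_mem_range_eq_of_andreDagger_mem_rat Φ h11 hpos hη e hS hSdag hu
  exact ⟨f, ⟨hf, hfi, hfd, hfr⟩, fun f' hf' ↦ eq_of_isIdempotentElem_of_andreDagger_eq_of_range_eq Φ hη e hf'.2.1 hfi hf'.2.2.1 hfd (hf'.2.2.2.trans hfr.symm)⟩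

include h11 hpos in
/-- **KAPLANSKY IN `S`, kernel form: a `†`-symmetric idempotent `q ∈ S` with `Ker q = Ker u`** (`q = 1 − f`, `f` the symmetric projector onto `Im(1 − vu) = Ker u`).
[cite: Berberian1972BaerRings, §1 Exercise 7C (p. 11), §3 Exercise 6A (p. 19: "`Ax = Ae`")] [cite: Kaplansky1968RingsOfOperators, Thm. 26] [cite: Andre1996Motifs, §4.2 (p. 19)] -/
theorem exists_isIdempotentElem_andreDagger_eq_mem_ker_eq_of_andreDagger_mem_rat (hS : S ≤ hodgeRatEnd Φ) (hSdag : ∀ u ∈ S, andreDagger Φ hη e u ∈ S)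
    {u : Module.End ℂ (GForm E ℂ)} (hu : u ∈ S) :
    ∃ q ∈ S, IsIdempotentElem q ∧ andreDagger Φ hη e q = q ∧ LinearMap.ker q = LinearMap.ker u := by
  obtain ⟨f, hf, hfi, hfk, -, -⟩ := exists_isIdempotentElem_mem_ker_eq_of_andreDagger_mem_rat Φ h11 hpos hη e hS hSdag hu
  obtain ⟨p, hp, hpi, hpd, hpr, -⟩ :=
    exists_isIdempotentElem_andreDagger_eq_mem_range_eq_of_andreDagger_mem_rat Φ h11 hpos hη e hS hSdag (sub_mem (one_mem _) hf : 1 - f ∈ S)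
  refine ⟨1 - p, sub_mem (one_mem _) hp, hpi.one_sub, ?_, ?_⟩
  · rw [andreDagger_sub, andreDagger_one, hpd]
  · rw [← LinearMap.IsIdempotentElem.range_eq_ker_one_sub hpi, hpr, ← LinearMap.IsIdempotentElem.ker_eq_range_one_sub hfi, hfk]

include h11 hpos in
/-- **UNIQUE EXISTENCE of the `†`-symmetric idempotent with kernel `Ker u`; it lies in `S`.** [cite: Berberian1972BaerRings, §1 Prop. 1 (3), Exercise 7C (p. 11)] -/
theorem existsUnique_isIdempotentElem_andreDagger_eq_mem_ker_eq_of_andreDagger_mem_rat (hS : S ≤ hodgeRatEnd Φ) (hSdag : ∀ u ∈ S, andreDagger Φ hη e u ∈ S)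
    {u : Module.End ℂ (GForm E ℂ)} (hu : u ∈ S) :
    ∃! q : Module.End ℂ (GForm E ℂ), q ∈ S ∧ IsIdempotentElem q ∧ andreDagger Φ hη e q = q ∧ LinearMap.ker q = LinearMap.ker u := by
  obtain ⟨q, hq, hqi, hqd, hqk⟩ := exists_isIdempotentElem_andreDagger_eq_mem_ker_eq_of_andreDagger_mem_rat Φ h11 hpos hη e hS hSdag hu
  exact ⟨q, ⟨hq, hqi, hqd, hqk⟩, fun q' hq' ↦ eq_of_isIdempotentElem_of_andreDagger_eq_of_ker_eq Φ hη e hq'.2.1 hqi hq'.2.2.1 hqd (hq'.2.2.2.trans hqk.symm)⟩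

end Subalgebra

/-! ## §3 The Hodge subalgebra `hodgeRatEndCircle Φ` of a polarised torus: semisimple, regular, with `†`-symmetric projectors -/

section CircleSemisimple

variable [Nontrivial E] (h11 : ∀ u v : E, η ![Complex.I • u, Complex.I • v] = η ![u, v]) (hpos : ∀ u : E, u ≠ 0 → 0 < η ![Complex.I • u, u])
  (hη : ∀ v : E, v ≠ 0 → ∃ w : E, η ![v, w] ≠ 0) {g : ℕ} (e : Fin (2 * g) ≃ ι)

include h11 hpos hη e in
/-- **The Hodge subalgebra `hodgeRatEndCircle Φ` is SEMISIMPLE** for a polarised complex torus (`η ∈ NS(X) ⊗ ℚ` of type (1,1) with `η(iu, u) > 0`, non-degenerate;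
`e : Fin (2g) ≃ ι`) — André's Prop. 3.3 for the genuine Hodge endomorphisms of the (Tate-normalised) total cohomology. [cite: Andre1996Motifs, Prop. 3.3 (p. 21),
Appendice Remarque 1 (p. 47)] [cite: Deligne1982HodgeCycles, I §1] -/
theorem IsNSForm.isSemisimpleRing_hodgeRatEndCircle (hNS : IsNSForm Φ η) : IsSemisimpleRing (hodgeRatEndCircle Φ) :=
  isSemisimpleRing_of_andreDagger_mem Φ h11 hpos hη e (hodgeRatEndCircle_le_hodgeRatEnd Φ) fun _ hu ↦ hNS.andreDagger_mem_hodgeRatEndCircle Φ hη e hu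

include h11 hpos hη e in
/-- **Von Neumann regularity of `hodgeRatEndCircle Φ`**: every Hodge endomorphism `u` has a Hodge quasi-inverse `v`, `u v u = u`. [cite: Andre1996Motifs, Prop. 3.3 (p. 21),
§4.2 (p. 19)] [cite: Lam2001FirstCourse, (4.27)] -/
theorem IsNSForm.exists_mem_hodgeRatEndCircle_mul_mul_eq_self (hNS : IsNSForm Φ η) {u : Module.End ℂ (GForm E ℂ)} (hu : u ∈ hodgeRatEndCircle Φ) :
    ∃ v ∈ hodgeRatEndCircle Φ, u * v * u = u :=
  exists_mem_mul_mul_eq_self_of_andreDagger_mem Φ h11 hpos hη e (hodgeRatEndCircle_le_hodgeRatEnd Φ) (fun _ hu ↦ hNS.andreDagger_mem_hodgeRatEndCircle Φ hη e hu) hu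

include h11 hpos in
/-- **For every Hodge endomorphism `u ∈ hodgeRatEndCircle Φ` there is a UNIQUE `†`-symmetric idempotent with image `Im u`, and it is a Hodge endomorphism** (the orthogonal
projector onto the sub-Hodge structure `Im u`, in `u · hodgeRatEndCircle Φ`). [cite: Berberian1972BaerRings, §1 Exercise 7C (p. 11)] [cite: Kaplansky1968RingsOfOperators, Thm. 26]
[cite: Lange2023AbelianVarietiesComplex, §2.4.3 Thm. 2.4.19 (p. 121)] [cite: Andre1996Motifs, §4.2 (p. 19)] -/
theorem IsNSForm.existsUnique_isIdempotentElem_andreDagger_eq_mem_hodgeRatEndCircle_range_eq (hNS : IsNSForm Φ η) {u : Module.End ℂ (GForm E ℂ)}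
    (hu : u ∈ hodgeRatEndCircle Φ) :
    ∃! f : Module.End ℂ (GForm E ℂ), f ∈ hodgeRatEndCircle Φ ∧ IsIdempotentElem f ∧ andreDagger Φ hη e f = f ∧ LinearMap.range f = LinearMap.range u :=
  existsUnique_isIdempotentElem_andreDagger_eq_mem_range_eq_of_andreDagger_mem_rat Φ h11 hpos hη e (hodgeRatEndCircle_le_hodgeRatEnd Φ)
    (fun _ hu ↦ hNS.andreDagger_mem_hodgeRatEndCircle Φ hη e hu) hu

include h11 hpos in
/-- **… and a UNIQUE `†`-symmetric idempotent Hodge endomorphism with kernel `Ker u`.** [cite: Berberian1972BaerRings, §1 Exercise 7C (p. 11), §3 Exercise 6A (p. 19)]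
[cite: Kaplansky1968RingsOfOperators, Thm. 26] [cite: Andre1996Motifs, §4.2 (p. 19)] -/
theorem IsNSForm.existsUnique_isIdempotentElem_andreDagger_eq_mem_hodgeRatEndCircle_ker_eq (hNS : IsNSForm Φ η) {u : Module.End ℂ (GForm E ℂ)}
    (hu : u ∈ hodgeRatEndCircle Φ) :
    ∃! q : Module.End ℂ (GForm E ℂ), q ∈ hodgeRatEndCircle Φ ∧ IsIdempotentElem q ∧ andreDagger Φ hη e q = q ∧ LinearMap.ker q = LinearMap.ker u :=
  existsUnique_isIdempotentElem_andreDagger_eq_mem_ker_eq_of_andreDagger_mem_rat Φ h11 hpos hη e (hodgeRatEndCircle_le_hodgeRatEnd Φ)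
    (fun _ hu ↦ hNS.andreDagger_mem_hodgeRatEndCircle Φ hη e hu) hu

/-- For a Riemann form (polarised abelian variety): **`hodgeRatEndCircle Φ` is semisimple.** [cite: Andre1996Motifs, Prop. 3.3 (p. 21)] [cite: Deligne1982HodgeCycles, I §1] -/
theorem IsRiemannForm.isSemisimpleRing_hodgeRatEndCircle (hR : IsRiemannForm Φ η) (e : Fin (2 * g) ≃ ι) : IsSemisimpleRing (hodgeRatEndCircle Φ) :=
  (hR.isNSForm Φ).isSemisimpleRing_hodgeRatEndCircle Φ hR.1 hR.2.2 (hR.exists_apply_ne_zero Φ) e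

/-- For a Riemann form: **every Hodge endomorphism `u ∈ hodgeRatEndCircle Φ` has a unique `†`-symmetric idempotent Hodge endomorphism with image `Im u`.**
[cite: Berberian1972BaerRings, §1 Exercise 7C (p. 11)] [cite: Kaplansky1968RingsOfOperators, Thm. 26] [cite: Lange2023AbelianVarietiesComplex, §2.4.3 Thm. 2.4.19 (p. 121)] -/
theorem IsRiemannForm.existsUnique_isIdempotentElem_andreDagger_eq_mem_hodgeRatEndCircle_range_eq (hR : IsRiemannForm Φ η) (e : Fin (2 * g) ≃ ι)
    {u : Module.End ℂ (GForm E ℂ)} (hu : u ∈ hodgeRatEndCircle Φ) :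
    ∃! f : Module.End ℂ (GForm E ℂ), f ∈ hodgeRatEndCircle Φ ∧ IsIdempotentElem f ∧ andreDagger Φ (hR.exists_apply_ne_zero Φ) e f = f ∧
      LinearMap.range f = LinearMap.range u :=
  (hR.isNSForm Φ).existsUnique_isIdempotentElem_andreDagger_eq_mem_hodgeRatEndCircle_range_eq Φ hR.1 hR.2.2 (hR.exists_apply_ne_zero Φ) e hu

/-- For a Riemann form: **… and a unique `†`-symmetric idempotent Hodge endomorphism with kernel `Ker u`.** [cite: Berberian1972BaerRings, §1 Exercise 7C (p. 11)]
[cite: Kaplansky1968RingsOfOperators, Thm. 26] -/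
theorem IsRiemannForm.existsUnique_isIdempotentElem_andreDagger_eq_mem_hodgeRatEndCircle_ker_eq (hR : IsRiemannForm Φ η) (e : Fin (2 * g) ≃ ι)
    {u : Module.End ℂ (GForm E ℂ)} (hu : u ∈ hodgeRatEndCircle Φ) :
    ∃! q : Module.End ℂ (GForm E ℂ), q ∈ hodgeRatEndCircle Φ ∧ IsIdempotentElem q ∧ andreDagger Φ (hR.exists_apply_ne_zero Φ) e q = q ∧
      LinearMap.ker q = LinearMap.ker u :=
  (hR.isNSForm Φ).existsUnique_isIdempotentElem_andreDagger_eq_mem_hodgeRatEndCircle_ker_eq Φ hR.1 hR.2.2 (hR.exists_apply_ne_zero Φ) e hu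

end CircleSemisimple

end ComplexTorus

end Literature.Geometry.Kaehler
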